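import Literature.AlgebraicGeometry.AbelianSchemes.AbelianSchemeKOfLFinite
import Literature.AlgebraicGeometry.AbelianSchemes.AbelianSchemeSteinOfNoetherian
import Literature.AlgebraicGeometry.Motives.SeesawRelativeSubscheme
import HarnessLib

/-!
# `K(L)` is a closed subscheme of `A`, finite over the base — UNCONDITIONAL for abelian schemes over an affine Noetherian base
# (Mumford, *Abelian Varieties* §13, with the seesaw theorem §10 and §6 Application 1)

Layer `Literature/AlgebraicGeometry/AbelianSchemes`, namespace `Literature.AlgebraicGeometry.AbelianSchemes.AbelianSchemeOver`.
Cell `hodgecm-mathlib` (D-0151), F-DAG price sheet §5 (h5-C) road (C1) «`K(L) ↪ A` closed, finite over `S`» — the PAYOFF of the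
(h8-E) engine port (author B-p08 (g12), file E13): B-p05 (g16)՚s ★ `exists_isClosedImmersion_isFinite_iff_memKOfL_of_univStein`
(`AbelianSchemeKOfLFinite`) and ★ `exists_isClosedImmersion_subgroup_iff_memKOfL` (`AbelianSchemeKOfLSeesaw`) take two residual
inputs — the universal Stein property `hSt : UnivStein A.X` and the relative-seesaw representabilities `hX` of the family
`(p₂ : A ×_R A → A, Λ(L))` — and both are THEOREMS for an abelian scheme over `Spec R`, `R` Noetherian:
* `univStein_of_isNoetherianRing` — ★ `AbelianSchemeOver.baseChange_app_bijective` ([GortzWedhorn2023] Cor. 24.63) read through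
  the identification `(snd A.X T).left = pullback.snd A.X.hom T.hom` of the cartesian-monoidal `Over (Spec R)`;
* `h0Repr_and_dualRepr_mumfordBundle` — ★ `SeesawRelative.h0Repr_and_dualRepr` (`Motives/SeesawRelativeSubscheme`, the relative
  Grothendieck complex of the product family `A ×_R A → A`; [MumfordAV1970] §5) with its instance binders supplied from the
  structure: `IsProper` (definition), `Flat`/`LocallyOfFinitePresentation`/`UniversallyOpen` (Mathlib: smooth ⇒ flat and locally of
  finite presentation ⇒ universally open), `GeometricallyIntegral` (★ `geometricallyIntegral_hom_overBase`), `IsLocallyNoetherian A.X.left`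
  (locally of finite type over a Noetherian base).
Hence THEOREMS ONLY (no definition, no instance, no named fact, no `sorry`):
* **`exists_isClosedImmersion_iff_memKOfL_of_isNoetherianRing`** — `K(L)` is (the functor of points of) a closed subscheme of `A`;
* **`exists_isClosedImmersion_subgroup_iff_memKOfL_of_isNoetherianRing`** — stable under unit / product / inverse;
* **`exists_isClosedImmersion_isFinite_iff_memKOfL_of_isNoetherianRing`** — and FINITE over `Spec R` when `L` is fibrewise of the class
  of an ample divisor ([MumfordAV1970] §6 Application 1),
for EVERY abelian scheme `A` over `Spec R` with `R` Noetherian and every rank-one `L` on `A` rigidified along the identity section — the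
only remaining hypotheses are `hL : HasRank L 1`, the rigidification `hε` and (for finiteness) the fibrewise ampleness `hΘ`.  HC_CM is
proved only modulo the 7 printed citations until rung 0 closes; this file asserts nothing about HC.

## References
* [MumfordAV1970] D. Mumford, *Abelian Varieties*, TIFR Studies in Mathematics 5 (1970), §5 Theorem (p. 46), §6 Application 1 (p. 60),
  §10 (p. 89), §13 (p. 123).
* [GortzWedhorn2023] U. Görtz, T. Wedhorn, *Algebraic Geometry II: Cohomology of Schemes* (2023), Cor. 24.63 (p. 404), Thm. 24.66
  (p. 405; proof pp. 407–408).
* [GortzWedhorn2020] U. Görtz, T. Wedhorn, *Algebraic Geometry I*, 2nd ed. (2020), Cor. 12.89 (p. 363).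
-/

set_option autoImplicit false

noncomputable section

-- `TopCat.Presheaf`/`Scheme.Modules` are not reducible (as in ★ `AbelianSchemeKOfL`).
set_option backward.isDefEq.respectTransparency false

universe u

open CategoryTheory CategoryTheory.Limits AlgebraicGeometry MonoidalCategory CartesianMonoidalCategory

open scoped MonObj

namespace Literature.AlgebraicGeometry.AbelianSchemes

open Literature.AlgebraicGeometry.Motives Literature.AlgebraicGeometry.AbelianVarieties
  Literature.AlgebraicGeometry.Modules Literature.AlgebraicGeometry.Morphisms

namespace AbelianSchemeOver

open SeesawRelative

variable {R : Type} [CommRing R] (A : AbelianSchemeOver (Spec (.of R)))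

/-- **An abelian scheme over a Noetherian affine base is universally Stein**: for every `R`-scheme `T` and every open `V ⊆ T`,
`Γ(V, 𝒪_T) → Γ(A ×_R V, 𝒪)` is bijective (★ `AbelianSchemeOver.baseChange_app_bijective` along `T → Spec R`, [GortzWedhorn2023]
Cor. 24.63; `(snd A.X T).left` is `pullback.snd A.X.hom T.hom`). [cite: GortzWedhorn2023, Cor. 24.63 (p. 404)] -/
theorem univStein_of_isNoetherianRing [IsNoetherianRing R] : SeesawRelative.UnivStein A.X := by
  intro T V
  have h := A.baseChange_app_bijective T.hom V
  exact h

/-- **The relative-seesaw representabilities `hX` of the family `(p₂ : A ×_R A → A, Λ(L))` HOLD** for an abelian scheme over a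
Noetherian affine base and `L` of rank one (★ `SeesawRelative.h0Repr_and_dualRepr` — the relative Grothendieck complex of the product
family, [MumfordAV1970] §5 — with `A → Spec R` proper, flat and universally open (smooth), geometrically integral
(★ `geometricallyIntegral_hom_overBase`) and `A` locally Noetherian (locally of finite type over a Noetherian base)).
[cite: MumfordAV1970, §5 Theorem (p. 46)] [cite: GortzWedhorn2023, Cor. 23.135 (p. 355)] -/
theorem h0Repr_and_dualRepr_mumfordBundle [IsNoetherianRing R] {L : A.left.Modules} (hL : HasRank L 1)
    (U : A.X.left.affineOpens) :
    SeesawRelative.H0Repr A.X (A.mumfordBundle L) U ∧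
      SeesawRelative.DualRepr A.X (A.mumfordBundle L) U (A.hasRank_mumfordBundle hL) := by
  haveI : IsProper A.X.hom := A.isProper
  haveI : Smooth A.X.hom := A.isSmooth
  haveI : GeometricallyIntegral A.X.hom := A.geometricallyIntegral_hom_overBase
  haveI : Flat A.X.hom := inferInstance
  haveI : LocallyOfFinitePresentation A.X.hom := inferInstance
  haveI : UniversallyOpen A.X.hom := inferInstance
  haveI : IsLocallyNoetherian A.X.left := LocallyOfFiniteType.isLocallyNoetherian A.X.hom
  exact SeesawRelative.h0Repr_and_dualRepr A.X (A.mumfordBundle L) (A.hasRank_mumfordBundle hL) U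

/-- **`K(L)` IS A CLOSED SUBSCHEME OF `A`** — unconditional over a Noetherian affine base: for `L` of rank one rigidified along the
identity section there is a closed immersion `i : Z ↪ A` over `Spec R` such that ANY `u : T → A` factors through `Z` iff `u ∈ K(L)(T)`
([MumfordAV1970] §13 definition of `K(L)` + the relative seesaw §10; B-p05 (g16)՚s ★ `exists_isClosedImmersion_iff_memKOfL` with its
inputs `hSt`, `hX` discharged). [cite: MumfordAV1970, §13 (p. 123)] [cite: GortzWedhorn2023, Thm. 24.66 (p. 405; proof pp. 407–408)] -/
theorem exists_isClosedImmersion_iff_memKOfL_of_isNoetherianRing [IsNoetherianRing R] {L : A.left.Modules} (hL : HasRank L 1)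
    (hε : CechPic.pullback A.unitSection (detClass (HasRank.isFiniteLocallyFree' hL)) = 1) :
    ∃ (Z : Over (Spec (.of R))) (i : Z ⟶ A.X) (_ : IsClosedImmersion i.left),
      ∀ (T : Over (Spec (.of R))) (u : T ⟶ A.X), (∃ v : T ⟶ Z, v ≫ i = u) ↔ A.MemKOfL L u :=
  haveI : GeometricallyIntegral A.X.hom := A.geometricallyIntegral_hom_overBase
  A.exists_isClosedImmersion_iff_memKOfL A.univStein_of_isNoetherianRing hL hε
    (fun U => A.h0Repr_and_dualRepr_mumfordBundle hL U)

/-- **`K(L)` is a closed subscheme of `A` STABLE UNDER THE GROUP LAW** (unit, product of the projections, inverse factor through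
it) — unconditional over a Noetherian affine base (★ `exists_isClosedImmersion_subgroup_iff_memKOfL` with `hSt`, `hX` discharged).
[cite: MumfordAV1970, §13 (p. 123)] [cite: GortzWedhorn2023, Thm. 24.66 (p. 405; proof pp. 407–408)] -/
theorem exists_isClosedImmersion_subgroup_iff_memKOfL_of_isNoetherianRing [IsNoetherianRing R] {L : A.left.Modules}
    (hL : HasRank L 1) (hε : CechPic.pullback A.unitSection (detClass (HasRank.isFiniteLocallyFree' hL)) = 1) :
    ∃ (Z : Over (Spec (.of R))) (i : Z ⟶ A.X) (_ : IsClosedImmersion i.left),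
      (∀ (T : Over (Spec (.of R))) (u : T ⟶ A.X), (∃ v : T ⟶ Z, v ≫ i = u) ↔ A.MemKOfL L u) ∧
      (∃ e : 𝟙_ (Over (Spec (.of R))) ⟶ Z, e ≫ i = 1) ∧
        (∃ m : Z ⊗ Z ⟶ Z, m ≫ i = (fst Z Z ≫ i) * (snd Z Z ≫ i)) ∧ ∃ n : Z ⟶ Z, n ≫ i = i⁻¹ :=
  haveI : GeometricallyIntegral A.X.hom := A.geometricallyIntegral_hom_overBase
  A.exists_isClosedImmersion_subgroup_iff_memKOfL A.univStein_of_isNoetherianRing hL hε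
    (fun U => A.h0Repr_and_dualRepr_mumfordBundle hL U)

/-- **`K(L)` IS A CLOSED SUBSCHEME OF `A`, FINITE OVER `Spec R`** — unconditional over a Noetherian affine base for `L` of rank one
rigidified along the identity section and fibrewise of the class of an ample divisor ([MumfordAV1970] §13 with the seesaw theorem
§10 and §6 Application 1; B-p05 (g16)՚s ★ `exists_isClosedImmersion_isFinite_iff_memKOfL_of_univStein` with its residual inputs
`hSt` (universal Stein property) and `hX` (relative-seesaw representabilities) DISCHARGED by `univStein_of_isNoetherianRing` and
`h0Repr_and_dualRepr_mumfordBundle`). [cite: MumfordAV1970, §6 Application 1 (p. 60) and §13 (p. 123)]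
[cite: GortzWedhorn2020, Cor. 12.89 (p. 363)] [cite: GortzWedhorn2023, Thm. 24.66 (p. 405; proof pp. 407–408)] -/
theorem exists_isClosedImmersion_isFinite_iff_memKOfL_of_isNoetherianRing [IsNoetherianRing R] {L : A.left.Modules}
    (hL : HasRank L 1) (hε : CechPic.pullback A.unitSection (detClass (HasRank.isFiniteLocallyFree' hL)) = 1)
    (hΘ : ∀ ⦃Ω : Type⦄ [Field Ω] [IsAlgClosed Ω] (s : Spec (.of Ω) ⟶ Spec (.of R)),
      ∃ Θ : CartierDivisor (A.fibre s).toAbelianVariety.X.left, Θ.IsAmple ∧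
        CechPic.pullback (X := (A.fibre s).toAbelianVariety.X.left) (pullback.fst A.X.hom s)
          (detClass (HasRank.isFiniteLocallyFree' hL)) = Θ.cechClass) :
    ∃ (Z : Over (Spec (.of R))) (i : Z ⟶ A.X) (_ : IsClosedImmersion i.left) (_ : IsFinite Z.hom),
      ∀ (T : Over (Spec (.of R))) (u : T ⟶ A.X), (∃ v : T ⟶ Z, v ≫ i = u) ↔ A.MemKOfL L u :=
  A.exists_isClosedImmersion_isFinite_iff_memKOfL_of_univStein A.univStein_of_isNoetherianRing hL hε
    (fun U => A.h0Repr_and_dualRepr_mumfordBundle hL U) hΘ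

end AbelianSchemeOver

end Literature.AlgebraicGeometry.AbelianSchemes

end
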